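/-
Copyright (c) 2026. All rights reserved.
Released under Apache 2.0 license as described in the file LICENSE.
Authors: abc-iut cell — seat abc-iut-w4-d104 (gen 2): the field `𝒜_𝕏 ∪ {0}` of [AbsTopIII] Def 4.1 (i)
(interface `LinHolField`, abc-iut-L4-t14/t2, p408080) INSTANTIATED at the germ MODEL of Prop 2.6 (this
seat's gen 0, p412533) for an arbitrary planar domain `U ⊆ ℂ`, with its tautological Kummer structure.
-/
import Literature.AnabelianGeometry.AbsoluteAnabelian.ArchimedeanLogFrobenius
import Literature.AnabelianGeometry.AbsoluteAnabelian.HolomorphicCoresLocalLinearProofs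
import HarnessLib

/-!
# [AbsTopIII] Prop 2.6 (a) "topological field structure on `𝒜_p ∪ {0}`" / Def 4.1 (i) `𝒜_𝕏` at the germ model

S. Mochizuki, *Topics in absolute anabelian geometry III* (bib key `MochizukiAbsTopIII2015`): Prop 2.6 (a)
(kurims p.57) "`ℂ^× ⥲ 𝒜_p` that is compatible with the topological field structures on
`ℂ = ℂ^× ∪ {0}`, `𝒜_p ∪ {0}`"; Def 4.1 (i) (p.101) "`𝒜_𝕏 := 𝒜_𝕏 ∪ {0}` … the `𝒜_p` of Corollary 2.7, (e) …
which may be identified … via the various isomorphisms `𝒜_p ⥲ 𝒜_{p'}`"; Def 4.1 (v) (p.105) "the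
tautological Kummer map `𝒜_𝕏 ⥲ 𝒜_𝕏`".

`HolomorphicCores.lean` (L4-t14) deliberately does not record the field structure on `𝒜_p ∪ {0}`;
`ArchimedeanLogFrobenius.lean` (p408080) types it as the INTERFACE `LinHolField L` (a normed field `F` with
`F^× ⥲ 𝒜_p` for every `p`, compatible with the transition isomorphisms).  The germ MODEL
`localLinearHolStructureOfGerms U` (p412533) inhabits that interface CANONICALLY with `F := ℂ` and
`unitsIso p := germAutIsoUnits p` (the tautological action, Prop 2.6 (a)) — compatibility with the
transitions is `germAutIsoUnits_trans` (Prop 2.6 (b)).  This file records: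

* `linHolFieldOfGerms U : LinHolField (localLinearHolStructureOfGerms U)` — the field `𝒜_𝕏 ∪ {0} = ℂ` of
  the germ model (ONE definition), with `rfl` lemmas;
* `kummerStructureOfGerms U : KummerStructure ℂ (linHolFieldOfGerms U)` — the tautological `ℂ`-Kummer
  structure (Def 4.1 (i)/(v): `κ = id`);
* `linHolFieldOfGerms_unitsIso_apply_val`: through `unitsIso p`, the unit `c ∈ ℂ^×` IS the germ
  `z ↦ p + c (z − p)` at `p` — the printed "compatible with the topological field structures" read as: the
  field structure on `𝒜_p ∪ {0}` is the one making the multiplier map a field isomorphism.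

(abc-iut-w5-d210's `ArchimedeanLogFrobeniusModelWitness.lean` p416878 builds the same shape for the whole
plane `𝕏 = ℂ` inside a proof; here it is the named instance over any `U ⊆ ℂ`.)  Refereed pre-IUT material;
nothing here bears on the disputed [IUTchIII] Cor. 3.12; typed ≠ endorsed.
-/

namespace Literature.AnabelianGeometry.AbsoluteAnabelian

open _root_.Complex _root_.Set _root_.Topology _root_.Filter

noncomputable section

/-- **Def 4.1 (i) at the germ model: the topological field `𝒜_𝕏 ∪ {0}`** of a planar domain `U ⊆ ℂ` with
its germ structure `localLinearHolStructureOfGerms U` is `ℂ`, identified with each `𝒜_p ∪ {0}` by the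
tautological action `germAutIsoUnits p : ℂ^× ⥲ 𝒜_p` (Prop 2.6 (a)); the identifications are compatible
with the transition isomorphisms `𝒜_p ⥲ 𝒜_{p'}` (Prop 2.6 (b), `germAutIsoUnits_trans`).
[cite: MochizukiAbsTopIII2015, Definition 4.1 (i) p.101] -/
def linHolFieldOfGerms (U : Set ℂ) : LinHolField (localLinearHolStructureOfGerms U) where
  F := ℂ
  unitsIso p := germAutIsoUnits (p : ℂ)
  unitsIso_trans p p' := germAutIsoUnits_trans (p : ℂ) (p' : ℂ)

/-- The field of the germ model is `ℂ`. [cite: MochizukiAbsTopIII2015, Definition 4.1 (i) p.101] -/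
theorem linHolFieldOfGerms_F (U : Set ℂ) : (linHolFieldOfGerms U).F = ℂ := rfl

/-- The identification `F^× ⥲ 𝒜_p` of the germ model is the tautological action.
[cite: MochizukiAbsTopIII2015, Proposition 2.6 (a) p.57] -/
theorem linHolFieldOfGerms_unitsIso (U : Set ℂ) (p : U) :
    (linHolFieldOfGerms U).unitsIso p = germAutIsoUnits (p : ℂ) := rfl

/-- **Prop 2.6 (a), "compatible with the topological field structures"**, at the model: through
`unitsIso p`, the unit `c` of the field `𝒜_𝕏 ∪ {0} = ℂ` is the germ of `z ↦ p + c (z − p)` at `p`.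
[cite: MochizukiAbsTopIII2015, Proposition 2.6 (a) p.57] -/
theorem linHolFieldOfGerms_unitsIso_apply_val (U : Set ℂ) (p : U) (c : ℂˣ) :
    (((germAutIsoUnits (p : ℂ) c : germAut (p : ℂ)) : (LocGerm (p : ℂ))ˣ) : LocGerm (p : ℂ)) =
        LocGerm.mulGerm (p : ℂ) c ∧
      (linHolFieldOfGerms U).unitsIso p = germAutIsoUnits (p : ℂ) :=
  ⟨val_germAutIsoUnits (p : ℂ) c, rfl⟩

/-- **Def 4.1 (i)/(v) at the germ model: the tautological `ℂ`-Kummer structure** `κ_ℂ = id : ℂ ⥲ 𝒜_𝕏 ∪ {0}`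
("the tautological Kummer map … given by the identity").
[cite: MochizukiAbsTopIII2015, Definition 4.1 (v) p.105] -/
def kummerStructureOfGerms (U : Set ℂ) : KummerStructure ℂ (linHolFieldOfGerms U) where
  κ := RingEquiv.refl ℂ
  continuous_κ := continuous_id
  continuous_κ_symm := continuous_id

/-- The tautological Kummer structure is the identity of `ℂ`.
[cite: MochizukiAbsTopIII2015, Definition 4.1 (v) p.105] -/
theorem kummerStructureOfGerms_κ_apply (U : Set ℂ) (z : ℂ) : (kummerStructureOfGerms U).κ z = z := rfl

/-- Non-vacuity: the interface `LinHolField` of Def 4.1 (i) is inhabited over the germ model of EVERY planar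
domain, and so is `KummerStructure ℂ`. [cite: MochizukiAbsTopIII2015, Definition 4.1 (i) p.101] -/
theorem nonempty_linHolField_localLinearHolStructureOfGerms (U : Set ℂ) :
    Nonempty (LinHolField (localLinearHolStructureOfGerms U)) ∧
      Nonempty (KummerStructure ℂ (linHolFieldOfGerms U)) :=
  ⟨⟨linHolFieldOfGerms U⟩, ⟨kummerStructureOfGerms U⟩⟩

end

end Literature.AnabelianGeometry.AbsoluteAnabelian
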